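import Literature.RepresentationTheory.KonnoKonno2007.RealUnitaryDualPairRelabel
import Literature.RepresentationTheory.KonnoKonno2007.RealUnitaryDualPairDefiniteFrame
import Literature.NumberTheory.Weil1964.ArchWeilDatumReindex
import HarnessLib

/-!
# Negating both hermitian forms of a real unitary dual pair: the role swap `(P,Q,R,S) ↦ (Q,P,S,R)` of the junction

Topic `RepresentationTheory/KonnoKonno2007`; namespace `Literature.RepresentationTheory.KonnoKonno2007.RealDualPair`.  KERNEL
MATHEMATICS ONLY: three explicit definitions (two topological group isomorphisms, one index bijection) and proved theorems; no
`def … : Prop` record, no axiom, no proof hole.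

The tree's real dual pair `Ginf P Q R S = UForm P Q × UForm R S` (`RealUnitaryDualPair`: `UForm α β = U(diag(1_α, −1_β))`) and its
symplectic action `ι𝕎 P Q R S = UForm.toSp ((P×R) ⊕ (Q×S)) ((P×S) ⊕ (Q×R)) ∘ toBig` only see the two hermitian forms through the
Kronecker product `h_V ⊗ h_W`.  Replacing BOTH forms by their negatives — reading `U(|P|,|Q|)` as `U(|Q|,|P|)` and `U(|R|,|S|)` as
`U(|S|,|R|)` — is therefore a symmetry of the junction: `U(J) = U(−J)` (`unitaryGroupOfForm_neg`), and on the block index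
`DPIdx P Q R S = ((P×R) ⊕ (Q×S)) ⊕ ((P×S) ⊕ (Q×R))` the swap `(P,Q,R,S) ↦ (Q,P,S,R)` is `Sum.swap` on EACH half: same-sign blocks go
to same-sign blocks and mixed blocks to mixed blocks, so the Fock polarisation (holomorphic on the first half, anti-holomorphic on
the second: `tw`) is RESPECTED — no complex conjugation is involved, and vacuum exponent tuples are permuted
`(e_P, e_Q, e_R, e_S) ↦ (e_Q, e_P, e_S, e_R)`.

* §1 **`UForm.negSwap α β : UForm α β ≃ₜ* UForm β α`** (`g ↦ reindex (Sum.swap) (Sum.swap) g`; `signForm_submatrix_sumComm`: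
  `diag(1_β,−1_α)` read through `Sum.swap` is `−diag(1_α,−1_β)`), its matrix `UForm.coe_negSwap`;
* §2 **`Ginf.negSwap P Q R S : Ginf P Q R S ≃ₜ* Ginf Q P S R`**, **`dpIdxNegSwap P Q R S : DPIdx P Q R S ≃ DPIdx Q P S R`**
  (`Sum.swap ⊕ Sum.swap`), the big-matrix identity `reindex_dpEquiv_kronecker_negSwap`, and the NATURALITY
  **`coe_ι𝕎_negSwap : ⇑(ι𝕎 Q P S R (Ginf.negSwap g)) = reindexPhase (dpIdxNegSwap …)⁻¹ ⇑(ι𝕎 P Q R S g)`**, homomorphism forms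
  `ι𝕎_negSwap`, `reindexSp_dpIdxNegSwap_ι𝕎_negSwap`, `ι𝕎_comp_negSwap_symm`;
* §3 **`isArchWeilDatum_negSwap`**: an archimedean Weil datum over `ι𝕎 P Q R S` transported along the index swap and precomposed
  with `(Ginf.negSwap)⁻¹` is an archimedean Weil datum over `ι𝕎 Q P S R` (`IsArchWeilDatum.reindex` + `.comp`) — the
  `U(q,p) × U(s,r)` reading of every `U(p,q) × U(r,s)` datum.

Use (pub-hodgecm model cell, rows A12/A34): the census slot at a real place where the definite space is read NEGATIVELY
(`U(∅, Fin 3) × U(S′, R′)`, orientation decided by an uncontrolled sign convention) is the `negSwap` of the positively read slot,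
where theta-1's unconditional linearised datum lives (`isArchWeilDatum_linWeil_neg_card`).

## References

* [KonnoKonno2007] K. Konno, T. Konno, Kyushu J. Math. 61 (2007), §3.1 (3.1) (the embedding `ι_{V,W}`; only `h_V ⊗ h_W` enters).
* [MoeglinVignerasWaldspurger1987] C. Mœglin, M.-F. Vignéras, J.-L. Waldspurger, LNM 1291 (1987), Ch. 1 I.17 (dual pairs are
  attached to the pair of forms up to a common scalar).
* [Weil1964] A. Weil, Acta Math. 111 (1964), Chap. I n° 12 p. 160 (relabelled symplectic spaces).
-/

set_option autoImplicit false

noncomputable section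

open Matrix
open scoped Kronecker

namespace Literature.RepresentationTheory.KonnoKonno2007

namespace RealDualPair

open Literature.Analysis.SegalBargmann Literature.RepresentationTheory.HeisenbergGroup
open Literature.NumberTheory.Automorphic Literature.NumberTheory.Weil1964

/-! ## §1 `U(α,β) ≃ₜ* U(β,α)`: negating the form -/

section UForm

variable (α β : Type*) [Fintype α] [DecidableEq α] [Fintype β] [DecidableEq β]

omit [Fintype α] [Fintype β] in
/-- `diag(1_β, −1_α)` read through `Sum.swap` is `−diag(1_α, −1_β)`. [folklore] -/
theorem signForm_submatrix_sumComm :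
    (signForm β α).submatrix (Equiv.sumComm α β) (Equiv.sumComm α β) = -signForm α β := by
  ext (i | i) (j | j) <;>
    simp [Matrix.fromBlocks_apply₁₁, Matrix.fromBlocks_apply₁₂, Matrix.fromBlocks_apply₂₁, Matrix.fromBlocks_apply₂₂,
      Matrix.one_apply]

/-- **`U(α, β) ≃ₜ* U(β, α)`** — the same matrices, the blocks listed in the other order: `g ↦ reindex Sum.swap Sum.swap g`.
The form is negated (`U(J) = U(−J)`, `unitaryGroupOfForm_neg`). [cite: MoeglinVignerasWaldspurger1987, Ch. 1 I.17] -/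
def UForm.negSwap : UForm α β ≃ₜ* UForm β α :=
  (subgroupCongrT ((unitaryGroupOfForm_neg (signForm α β)).symm.trans
      (congrArg (unitaryGroupOfForm (starRingEnd ℂ)) (signForm_submatrix_sumComm α β)).symm)).trans
    (unitaryGroupOfFormReindex (starRingEnd ℂ) (Equiv.sumComm α β) (signForm β α))

variable {α β}

/-- matrix of `UForm.negSwap g`: `reindex Sum.swap Sum.swap g`. [folklore] -/
@[simp] theorem UForm.coe_negSwap (g : UForm α β) :
    (((UForm.negSwap α β g : UForm β α) : GL (β ⊕ α) ℂ) : Matrix (β ⊕ α) (β ⊕ α) ℂ) =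
      Matrix.reindex (Equiv.sumComm α β) (Equiv.sumComm α β) ((g : GL (α ⊕ β) ℂ) : Matrix (α ⊕ β) (α ⊕ β) ℂ) :=
  rfl

end UForm

/-! ## §2 `G_∞`, `DPIdx` and `ι𝕎` under the role swap -/

section Pair

variable (P Q R S : Type*) [Fintype P] [DecidableEq P] [Fintype Q] [DecidableEq Q] [Fintype R] [DecidableEq R]
  [Fintype S] [DecidableEq S]

/-- **`G_∞(P,Q,R,S) ≃ₜ* G_∞(Q,P,S,R)`**, factor by factor. [cite: KonnoKonno2007, §3.1] -/
def Ginf.negSwap : Ginf P Q R S ≃ₜ* Ginf Q P S R :=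
  { (UForm.negSwap P Q).toMulEquiv.prodCongr (UForm.negSwap R S).toMulEquiv with
    continuous_toFun := (UForm.negSwap P Q).continuous.prodMap (UForm.negSwap R S).continuous
    continuous_invFun := (UForm.negSwap P Q).symm.continuous.prodMap (UForm.negSwap R S).symm.continuous }

/-- **the role swap on the block index**: `Sum.swap` on the same-sign half `(P×R) ⊕ (Q×S)` and on the mixed half
`(P×S) ⊕ (Q×R)` — blocks keep their polarisation type. [folklore] -/
def dpIdxNegSwap : DPIdx P Q R S ≃ DPIdx Q P S R :=
  Equiv.sumCongr (Equiv.sumComm (P × R) (Q × S)) (Equiv.sumComm (P × S) (Q × R))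

variable {P Q R S}

/-- components of `Ginf.negSwap`. [folklore] -/
@[simp] theorem Ginf.negSwap_apply (g : Ginf P Q R S) :
    Ginf.negSwap P Q R S g = (UForm.negSwap P Q g.1, UForm.negSwap R S g.2) := rfl

/-- the big matrix of the swapped pair element is the big matrix relabelled by `dpIdxNegSwap`. [folklore] -/
theorem reindex_dpEquiv_kronecker_negSwap (g : Ginf P Q R S) :
    Matrix.reindex (dpEquiv Q P S R) (dpEquiv Q P S R)
        ((((UForm.negSwap P Q g.1 : UForm Q P) : GL (Q ⊕ P) ℂ) : Matrix (Q ⊕ P) (Q ⊕ P) ℂ) ⊗ₖ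
          (((UForm.negSwap R S g.2 : UForm S R) : GL (S ⊕ R) ℂ) : Matrix (S ⊕ R) (S ⊕ R) ℂ)) =
      Matrix.reindex (dpIdxNegSwap P Q R S) (dpIdxNegSwap P Q R S)
        (Matrix.reindex (dpEquiv P Q R S) (dpEquiv P Q R S)
          (((g.1 : GL (P ⊕ Q) ℂ) : Matrix (P ⊕ Q) (P ⊕ Q) ℂ) ⊗ₖ ((g.2 : GL (R ⊕ S) ℂ) : Matrix (R ⊕ S) (R ⊕ S) ℂ))) := by
  rw [UForm.coe_negSwap, UForm.coe_negSwap, Matrix.kroneckerMap_reindex]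
  simp only [Matrix.reindex_apply, Matrix.submatrix_submatrix]
  congr 1 <;> (funext x; rcases x with ((⟨q, s⟩ | ⟨p, r⟩) | (⟨q, r⟩ | ⟨p, s⟩)) <;> rfl)

omit [Fintype P] [DecidableEq P] [Fintype Q] [DecidableEq Q] [Fintype R] [DecidableEq R] [Fintype S] [DecidableEq S] in
/-- `dpIdxNegSwap` IS the block-respecting relabelling `Sum.swap ⊕ Sum.swap` of the big pair's index (definitional). [folklore] -/
theorem dpIdxNegSwap_eq_sumCongr :
    dpIdxNegSwap P Q R S = Equiv.sumCongr (Equiv.sumComm (P × R) (Q × S)) (Equiv.sumComm (P × S) (Q × R)) := rfl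

/-- **`ι𝕎` is natural under the role swap** (phase-map form): the action of the swapped pair element is the original action
conjugated by `dpIdxNegSwap`. [cite: KonnoKonno2007, §3.1 (3.1); MoeglinVignerasWaldspurger1987, Ch. 1 I.17] -/
theorem coe_ι𝕎_negSwap (g : Ginf P Q R S) :
    (⇑((ι𝕎 Q P S R (Ginf.negSwap P Q R S g)).1 :
        ((DPIdx Q P S R → ℝ) × (DPIdx Q P S R → ℝ)) ≃ₗ[ℝ] ((DPIdx Q P S R → ℝ) × (DPIdx Q P S R → ℝ))) :
        PhaseMap (DPIdx Q P S R)) =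
      reindexPhase (dpIdxNegSwap P Q R S).symm
        (⇑((ι𝕎 P Q R S g).1 :
          ((DPIdx P Q R S → ℝ) × (DPIdx P Q R S → ℝ)) ≃ₗ[ℝ] ((DPIdx P Q R S → ℝ) × (DPIdx P Q R S → ℝ)))) := by
  funext w
  rw [ι𝕎_apply, Ginf.negSwap_apply, reindex_dpEquiv_kronecker_negSwap, dpIdxNegSwap_eq_sumCongr,
    twRealify_reindex_sumCongr]
  rfl

/-- **`ι𝕎` is natural under the role swap** (homomorphism form). [cite: KonnoKonno2007, §3.1 (3.1)] -/
theorem ι𝕎_negSwap (g : Ginf P Q R S) :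
    ι𝕎 Q P S R (Ginf.negSwap P Q R S g) = reindexSp (dpIdxNegSwap P Q R S).symm (ι𝕎 P Q R S g) := by
  apply Subtype.ext
  apply LinearEquiv.ext
  intro w
  have h := congrFun (coe_ι𝕎_negSwap g) w
  rwa [← coe_reindexSp] at h

/-- … equivalently `reindexSp (dpIdxNegSwap …) (ι𝕎′ (negSwap g)) = ι𝕎 g`. [cite: KonnoKonno2007, §3.1 (3.1)] -/
theorem reindexSp_dpIdxNegSwap_ι𝕎_negSwap (g : Ginf P Q R S) :
    reindexSp (dpIdxNegSwap P Q R S) (ι𝕎 Q P S R (Ginf.negSwap P Q R S g)) = ι𝕎 P Q R S g := by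
  rw [ι𝕎_negSwap, reindexSp_reindexSp_symm]

/-- **the swapped junction as a composite**: `ι𝕎 Q P S R = reindexSp (dpIdxNegSwap)⁻¹ ∘ ι𝕎 P Q R S ∘ (negSwap)⁻¹`.
[cite: KonnoKonno2007, §3.1 (3.1)] -/
theorem ι𝕎_eq_comp_negSwap_symm :
    ι𝕎 Q P S R =
      ((reindexSp (dpIdxNegSwap P Q R S).symm).comp (ι𝕎 P Q R S)).comp
        (Ginf.negSwap P Q R S).symm.toMulEquiv.toMonoidHom := by
  ext1 g
  rw [MonoidHom.comp_apply, MonoidHom.comp_apply, MulEquiv.coe_toMonoidHom, ContinuousMulEquiv.toMulEquiv_eq_coe]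
  have h := ι𝕎_negSwap ((Ginf.negSwap P Q R S).symm g)
  rw [ContinuousMulEquiv.apply_symm_apply] at h
  rw [h]
  rfl

end Pair

/-! ## §3 Archimedean Weil data under the role swap -/

section Datum

variable {P Q R S : Type*} [Fintype P] [DecidableEq P] [Fintype Q] [DecidableEq Q] [Fintype R] [DecidableEq R]
  [Fintype S] [DecidableEq S]

/-- **An archimedean Weil datum of `U(p,q) × U(r,s)` read as one of `U(q,p) × U(s,r)`**: transport along the index swap
`dpIdxNegSwap` and precompose with `(Ginf.negSwap)⁻¹`. [cite: KonnoKonno2007, §3.1; MoeglinVignerasWaldspurger1987, Ch. 1 I.17] -/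
theorem isArchWeilDatum_negSwap {ω : Representation ℂ (Ginf P Q R S) (SchwartzMap (DPIdx P Q R S → ℝ) ℂ)}
    (hW : IsArchWeilDatum (ι𝕎 P Q R S) ω) :
    IsArchWeilDatum (ι𝕎 Q P S R)
      ((repTransport (reindexCLE (dpIdxNegSwap P Q R S).symm) ω).comp
        (Ginf.negSwap P Q R S).symm.toMulEquiv.toMonoidHom) := by
  rw [ι𝕎_eq_comp_negSwap_symm]
  exact (hW.reindex (dpIdxNegSwap P Q R S).symm).comp _ (Ginf.negSwap P Q R S).symm.continuous

/-- the operators of the swapped datum are continuous when the original ones are. [folklore] -/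
theorem continuous_negSwap_apply {ω : Representation ℂ (Ginf P Q R S) (SchwartzMap (DPIdx P Q R S → ℝ) ℂ)}
    (hc : ∀ g, Continuous (ω g)) (u : Ginf Q P S R) :
    Continuous ((repTransport (reindexCLE (dpIdxNegSwap P Q R S).symm) ω).comp
      (Ginf.negSwap P Q R S).symm.toMulEquiv.toMonoidHom u) :=
  continuous_repTransport_reindexCLE _ hc _

end Datum

end RealDualPair

end Literature.RepresentationTheory.KonnoKonno2007

end
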